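import Literature.Geometry.Lorentzian.BoundedGeometry
import Summits.FinalStateConjecture.FinalStateConjecture.Theorems.EIHFluxBalanceInertialRecessionStubPseudotensorBoundMatrix
import Summits.FinalStateConjecture.FinalStateConjecture.Theorems.RenormalisedDriftDriftCaptureSeamAffineApproximation
import Summits.FinalStateConjecture.FinalStateConjecture.Theorems.RenormalisedDriftDriftCaptureChristoffelTransport
import HarnessLib

/-!
# Crux `DriftCapture` (stmt-FinalStateConjecture-17391), stub `stub_glueForwardChain`:
# seam rigidity (G1) on convex cells — a transition map between two `C¹`-nearly-flat charts is
# `C⁰`/`C¹`/`C²`-close to ONE Poincaré map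

This file is a BRICK for the registered stub `stub_glueForwardChain` (GLUE) of crux
stmt-FinalStateConjecture-17391 (`DriftCapture`): the analytic content of SEAM RIGIDITY (G1) on
convex cells, ASSEMBLED from the two landed bricks
`RenormalisedDriftDriftCaptureSeamAffineApproximation` (affine Poincaré approximation of `C¹`
near-`η`-isometries with a second-derivative bound, p172337) and
`RenormalisedDriftDriftCaptureChristoffelTransport` (the Hessian of a transition map is controlled
by the first derivatives of the two metric fields it intertwines, p172704).

Setting. On a convex open cell `C ⊆ E4` of diameter `≤ dC` let `θ : C → E4` be a `C²` transition
map between two charts whose pulled-back metrics are `g₁' = η + F₁` (on the cell) and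
`g₂' = η + F₂` (on its image), both `δ`-close to the Minkowski form `η = Minkowski.bilin` in `C¹`
(`‖Fᵢ‖, ‖DFᵢ‖ ≤ δ` pointwise), with `θ^* g₂' = g₁'`
(`bilinPullback θ (η + F₂) = η + F₁` on `C`) and the a-priori Jacobian bound `‖Dθ‖ ≤ Θ`.

* Minkowski algebra is REUSED from the tree: the time flip `ṽ = v − 2v⁰∂₀` with `η(v, ṽ) = ‖v‖²`,
  `‖ṽ‖ = ‖v‖` and the coercivity `‖v‖²/2 ≤ B(v, ṽ)` for `‖B − η‖ ≤ 1/2`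
  (`SublinearIsFree.PseudotensorBound.minkowski_apply_reflect`, `norm_reflect`, `coercive`, landed
  file `EIHFluxBalanceInertialRecessionStubPseudotensorBoundMatrix`), and `|η(v, w)| ≤ ‖v‖ ‖w‖`
  (`Minkowski.abs_bilin_le`, `Literature/Geometry/Lorentzian/BoundedGeometry`);
* `abs_defect_le_of_intertwine` — step (1): the `η`-defect of `L = Dθ(x)` is at most
  `δ (1 + Θ²) ‖v‖ ‖w‖` (evaluate the intertwining identity on `(v, w)`);
* `norm_le_two_mul_mul_norm_apply_of_defect_le` — step (2): an `η`-defect `≤ ‖v‖‖w‖/2` and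
  `‖L‖ ≤ Θ` force the lower bound `‖v‖ ≤ 2Θ ‖L v‖` (test against the time flip; no inverse needed);
* `norm_le_two_mul_norm_add_apply` — step (3): `η + A` with `‖A‖ ≤ 1/2` is `2`-nondegenerate,
  `‖p‖ ≤ 2 ‖(η + A) p‖`;
* `exists_seamRigidityFlat_delta` — the bookkeeping choice of `δ = δ(Θ, dC, ε, K, δₐ)`;
* `seamRigidityFlat_pointwise` — steps (1)–(4) at one point of an open set: the defect bound and
  the Hessian bound `‖D²θ(x)‖ ≤ K (δ + δ)` from the Christoffel brick with `(Θ', ν) = (2Θ, 2)`;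
* `seamRigidityFlat_convex` — the registered sub-goal: for all `Θ dC ε`, `ε > 0`, there is
  `δ > 0` such that on every convex open cell of diameter `≤ dC`, for every base point `x₀ ∈ C`
  there is ONE `Λ ∈ O(1,3)` with `‖Dθ(x) − Λ‖ ≤ ε`, `‖(θ x − θ x₀) − Λ(x − x₀)‖ ≤ ε ‖x − x₀‖`
  and `‖D²θ(x)‖ ≤ ε` for all `x ∈ C` (the affine brick, fed with the pointwise bounds).

What is deliberately NOT here: no statement on entire (long, thin) slabs — closeness to ONE Poincaré
map on a whole slab is false in general (F. John 1961: the rotation part of a map with uniformly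
small strain may drift logarithmically with the aspect ratio; Reshetnyak's stability theory is
likewise local/per-ball), which is why (G1) is per convex cell and the gluing stub patches cells;
no rate in `δ`; no Kerr seams (G1K, which needs the isometry group of Kerr); no chart packaging
against `ApproximateKerrConfiguration.flatChart` (that remains with the GLUE stub).

References (context only; the proofs are the two landed bricks plus Mathlib's `fderiv` calculus):
F. John, *Rotation and strain*, Comm. Pure Appl. Math. 14 (1961), 391–413; Yu. G. Reshetnyak,
*Stability theorems in geometry and analysis* (Nauka 1982; Engl. transl. Kluwer 1994), Ch. 3;
B. O'Neill, *Semi-Riemannian Geometry* (1983), Ch. 3 (Prop. 3.13, Prop. 3.59: Christoffel symbols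
and isometries) and Ch. 9, pp. 233–236 (the Lorentz group). All statements here are `[folklore]`.
-/

-- the doubled `FinalStateConjecture.FinalStateConjecture` path component trips dupNamespace
set_option linter.dupNamespace false
-- operator norms of trilinear maps `E4 →L[ℝ] E4 →L[ℝ] E4 →L[ℝ] ℝ` (the type of `fderiv ℝ F x` for a
-- field of bilinear forms `F`) need nested instance synthesis of depth `3` (Mathlib's own setting)
set_option maxSynthPendingDepth 3

noncomputable section

namespace Summit.FinalStateConjecture.FinalStateConjecture.Theorems.RenormalisedDrift.DriftCapture

open Set Filter Topology Metric
open Literature.Geometry.Lorentzian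
open SublinearIsFree.PseudotensorBound (minkowski_apply_reflect norm_reflect coercive)

/-! ### Steps (1)–(3): defect, lower bound, nondegeneracy -/

/-- **Step (1): small `η`-defect of the Jacobian.** If `η(Lv, Lw) + A₂(Lv, Lw) = η(v, w) + A₁(v, w)`
for all `v w` (the intertwining identity `θ^*(η + F₂) = η + F₁` evaluated at a point, `L = Dθ(x)`,
`A₁ = F₁(x)`, `A₂ = F₂(θ x)`), `‖A₁‖, ‖A₂‖ ≤ δ` and `‖L‖ ≤ Θ`, then
`|η(Lv, Lw) − η(v, w)| ≤ δ (1 + Θ²) ‖v‖ ‖w‖`. [folklore] -/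
theorem abs_defect_le_of_intertwine {L : E4 →L[ℝ] E4} {A₁ A₂ : E4 →L[ℝ] E4 →L[ℝ] ℝ} {δ Θ : ℝ}
    (h : ∀ v w : E4,
      Minkowski.bilin (L v) (L w) + A₂ (L v) (L w) = Minkowski.bilin v w + A₁ v w)
    (hA₁ : ‖A₁‖ ≤ δ) (hA₂ : ‖A₂‖ ≤ δ) (hL : ‖L‖ ≤ Θ) (v w : E4) :
    |Minkowski.bilin (L v) (L w) - Minkowski.bilin v w| ≤ δ * (1 + Θ ^ 2) * ‖v‖ * ‖w‖ := by
  have hδ0 : 0 ≤ δ := (norm_nonneg _).trans hA₁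
  have hΘ0 : 0 ≤ Θ := (norm_nonneg _).trans hL
  have heq : Minkowski.bilin (L v) (L w) - Minkowski.bilin v w = A₁ v w - A₂ (L v) (L w) := by
    linear_combination h v w
  have h1 : |A₁ v w| ≤ δ * ‖v‖ * ‖w‖ := by
    rw [← Real.norm_eq_abs]
    exact (A₁.le_opNorm₂ v w).trans (by gcongr)
  have h2 : |A₂ (L v) (L w)| ≤ δ * (Θ * ‖v‖) * (Θ * ‖w‖) := by
    rw [← Real.norm_eq_abs]
    calc ‖A₂ (L v) (L w)‖ ≤ ‖A₂‖ * ‖L v‖ * ‖L w‖ := A₂.le_opNorm₂ _ _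
      _ ≤ δ * (Θ * ‖v‖) * (Θ * ‖w‖) := by
          gcongr
          · exact (L.le_opNorm v).trans (mul_le_mul_of_nonneg_right hL (norm_nonneg _))
          · exact (L.le_opNorm w).trans (mul_le_mul_of_nonneg_right hL (norm_nonneg _))
  rw [heq]
  calc |A₁ v w - A₂ (L v) (L w)| ≤ |A₁ v w| + |A₂ (L v) (L w)| := abs_sub _ _
    _ ≤ δ * ‖v‖ * ‖w‖ + δ * (Θ * ‖v‖) * (Θ * ‖w‖) := add_le_add h1 h2
    _ = δ * (1 + Θ ^ 2) * ‖v‖ * ‖w‖ := by ring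

/-- **Step (2): lower bound on the Jacobian, without inverses.** If the `η`-defect of `L` is at
most `c ‖v‖ ‖w‖` with `c ≤ 1/2` and `‖L‖ ≤ Θ`, then `‖v‖ ≤ 2Θ ‖L v‖` for every `v`: test the
defect inequality against the time flip `w = v − 2v⁰∂₀`, for which `η(v, w) = ‖v‖²` and
`‖w‖ = ‖v‖` (landed: `SublinearIsFree.PseudotensorBound.minkowski_apply_reflect`, `norm_reflect`),
so `‖v‖² ≤ |η(Lv, Lw)| + c‖v‖² ≤ ‖Lv‖ Θ ‖v‖ + ‖v‖²/2` (`Minkowski.abs_bilin_le`). [folklore] -/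
theorem norm_le_two_mul_mul_norm_apply_of_defect_le {L : E4 →L[ℝ] E4} {c Θ : ℝ}
    (h : ∀ v w : E4, |Minkowski.bilin (L v) (L w) - Minkowski.bilin v w| ≤ c * ‖v‖ * ‖w‖)
    (hc : c ≤ 1 / 2) (hL : ‖L‖ ≤ Θ) (v : E4) : ‖v‖ ≤ 2 * Θ * ‖L v‖ := by
  set w : E4 := v - (2 * v 0) • E4.basisVector 0 with hw
  have hvw : Minkowski.bilin v w = ‖v‖ ^ 2 := minkowski_apply_reflect v
  have hnw : ‖w‖ = ‖v‖ := norm_reflect v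
  have hΘ0 : 0 ≤ Θ := (norm_nonneg _).trans hL
  have hLw : ‖L w‖ ≤ Θ * ‖v‖ :=
    (L.le_opNorm w).trans (by rw [hnw]; exact mul_le_mul_of_nonneg_right hL (norm_nonneg _))
  have h1 : |Minkowski.bilin (L v) (L w)| ≤ ‖L v‖ * (Θ * ‖v‖) :=
    (Minkowski.abs_bilin_le _ _).trans (mul_le_mul_of_nonneg_left hLw (norm_nonneg _))
  have h2 := h v w
  rw [hvw, hnw] at h2
  have hsq : ‖v‖ * ‖v‖ ≤ 2 * Θ * ‖L v‖ * ‖v‖ := by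
    have e1 := (abs_le.1 h1).2
    have e2 := (abs_le.1 h2).1
    nlinarith [mul_nonneg (norm_nonneg v) (norm_nonneg v), sq_nonneg ‖v‖]
  by_cases hv : v = 0
  · simp [hv]
  · exact le_of_mul_le_mul_right hsq (norm_pos_iff.2 hv)

/-- **Step (3): nondegeneracy of a nearly flat metric.** If `‖A‖ ≤ 1/2` then `η + A` is
`2`-nondegenerate: `‖p‖ ≤ 2 ‖(η + A) p‖` — test the functional `(η + A) p` against the time flip
`p̃` of `p`: by the landed coercivity `SublinearIsFree.PseudotensorBound.coercive`,
`‖p‖²/2 ≤ (η + A)(p, p̃) ≤ ‖(η + A) p‖ ‖p‖`. O'Neill 1983, Ch. 3, p. 55 (`η` itself is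
nondegenerate). [folklore] -/
theorem norm_le_two_mul_norm_add_apply {A : E4 →L[ℝ] E4 →L[ℝ] ℝ} (hA : ‖A‖ ≤ 1 / 2) (p : E4) :
    ‖p‖ ≤ 2 * ‖(Minkowski.bilin + A) p‖ := by
  have hB : ‖(Minkowski.bilin + A) - Minkowski.bilin‖ ≤ 1 / 2 := by rwa [add_sub_cancel_left]
  have h1 : ‖p‖ ^ 2 / 2 ≤ ‖(Minkowski.bilin + A) p‖ * ‖p‖ :=
    calc ‖p‖ ^ 2 / 2 ≤ (Minkowski.bilin + A) p (p - (2 * p 0) • E4.basisVector 0) := coercive hB p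
      _ ≤ ‖(Minkowski.bilin + A) p (p - (2 * p 0) • E4.basisVector 0)‖ := Real.le_norm_self _
      _ ≤ ‖(Minkowski.bilin + A) p‖ * ‖p - (2 * p 0) • E4.basisVector 0‖ :=
          ((Minkowski.bilin + A) p).le_opNorm _
      _ = ‖(Minkowski.bilin + A) p‖ * ‖p‖ := by rw [norm_reflect]
  have hsq : ‖p‖ * ‖p‖ ≤ 2 * ‖(Minkowski.bilin + A) p‖ * ‖p‖ := by nlinarith [sq_nonneg ‖p‖]
  by_cases hp : p = 0
  · simp [hp]
  · exact le_of_mul_le_mul_right hsq (norm_pos_iff.2 hp)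

/-! ### Bookkeeping: the choice of `δ` -/

/-- The choice of `δ = δ(Θ, dC, ε, K, δₐ) > 0` making every smallness condition of the assembly
hold: `δ(1 + Θ²) ≤ 1/2` (steps (2), (3)), `δ(1 + Θ²) ≤ δₐ` (defect input of the affine brick),
`K(δ + δ) ≤ ε` (the `C²` clause) and `K(δ + δ)|dC| ≤ δₐ` (oscillation input of the affine brick).
[folklore] -/
theorem exists_seamRigidityFlat_delta (Θ dC ε K δa : ℝ) (hε : 0 < ε) (hK : 0 ≤ K)
    (hδa : 0 < δa) :
    ∃ δ : ℝ, 0 < δ ∧ δ * (1 + Θ ^ 2) ≤ 1 / 2 ∧ δ * (1 + Θ ^ 2) ≤ δa ∧ K * (δ + δ) ≤ ε ∧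
      K * (δ + δ) * |dC| ≤ δa := by
  have hΘ : 0 < 1 + Θ ^ 2 := by positivity
  have hK1 : 0 < 2 * K + 1 := by positivity
  have hD : 0 < (2 * K + 1) * (|dC| + 1) := by positivity
  refine ⟨min (min (1 / (2 * (1 + Θ ^ 2))) (δa / (1 + Θ ^ 2)))
    (min (ε / (2 * K + 1)) (δa / ((2 * K + 1) * (|dC| + 1)))), ?_, ?_, ?_, ?_, ?_⟩
  · positivity
  · have h : min (min (1 / (2 * (1 + Θ ^ 2))) (δa / (1 + Θ ^ 2)))
        (min (ε / (2 * K + 1)) (δa / ((2 * K + 1) * (|dC| + 1)))) ≤ 1 / (2 * (1 + Θ ^ 2)) :=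
      (min_le_left _ _).trans (min_le_left _ _)
    rw [le_div_iff₀ (by positivity)] at h
    linarith
  · have h : min (min (1 / (2 * (1 + Θ ^ 2))) (δa / (1 + Θ ^ 2)))
        (min (ε / (2 * K + 1)) (δa / ((2 * K + 1) * (|dC| + 1)))) ≤ δa / (1 + Θ ^ 2) :=
      (min_le_left _ _).trans (min_le_right _ _)
    rwa [le_div_iff₀ hΘ] at h
  · set δ := min (min (1 / (2 * (1 + Θ ^ 2))) (δa / (1 + Θ ^ 2)))
      (min (ε / (2 * K + 1)) (δa / ((2 * K + 1) * (|dC| + 1)))) with hδ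
    have hδ0 : 0 ≤ δ := by positivity
    have h : δ ≤ ε / (2 * K + 1) := (min_le_right _ _).trans (min_le_left _ _)
    rw [le_div_iff₀ hK1] at h
    nlinarith
  · set δ := min (min (1 / (2 * (1 + Θ ^ 2))) (δa / (1 + Θ ^ 2)))
      (min (ε / (2 * K + 1)) (δa / ((2 * K + 1) * (|dC| + 1)))) with hδ
    have hδ0 : 0 ≤ δ := by positivity
    have h : δ ≤ δa / ((2 * K + 1) * (|dC| + 1)) := (min_le_right _ _).trans (min_le_right _ _)
    rw [le_div_iff₀ hD] at h
    nlinarith [mul_nonneg hK hδ0, mul_nonneg hδ0 (abs_nonneg dC),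
      mul_nonneg (mul_nonneg hK hδ0) (abs_nonneg dC)]

/-! ### Step (4) and the pointwise core -/

/-- **Seam rigidity, pointwise core (steps (1)–(4)).** For every Jacobian bound `Θ` there is
`K = K(Θ) ≥ 0` such that: if `θ : E4 → E4` is `C²` on an open set `s ∋ x` and intertwines the two
nearly flat metric fields `η + F₂` (on the target) and `η + F₁` (on `s`),
`bilinPullback θ (η + F₂) = η + F₁` on `s`, where `F₁` is differentiable at `x`, `F₂` at `θ x`,
`‖F₁(x)‖, ‖F₂(θ x)‖, ‖DF₁(x)‖, ‖DF₂(θ x)‖ ≤ δ`, `F₂(θ x)` is symmetric, `‖Dθ(x)‖ ≤ Θ` and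
`δ(1 + Θ²) ≤ 1/2`, then (1) the `η`-defect of `Dθ(x)` is at most `δ(1 + Θ²)‖v‖‖w‖`, and (4) the
Hessian is small, `‖D²θ(x)‖ ≤ K(δ + δ)` — the Christoffel transport brick
`norm_iteratedFDeriv_two_le_of_bilinPullback_eq` with `(Θ', ν) = (2Θ, 2)`, whose lower-bound and
nondegeneracy inputs are steps (2) and (3). O'Neill 1983, Ch. 3, Prop. 3.13, Prop. 3.59 (the
transformation law of the Christoffel symbols, read as an estimate). [folklore] -/
theorem seamRigidityFlat_pointwise : ∀ (Θ : ℝ), ∃ K : ℝ, 0 ≤ K ∧ ∀ (θ : E4 → E4) (F₁ F₂ : E4 → E4 →L[ℝ] E4 →L[ℝ] ℝ) (s : Set E4) (x : E4) (δ : ℝ), IsOpen s → x ∈ s → ContDiffOn ℝ 2 θ s → DifferentiableAt ℝ F₁ x → DifferentiableAt ℝ F₂ (θ x) → ‖F₁ x‖ ≤ δ → ‖F₂ (θ x)‖ ≤ δ → ‖fderiv ℝ F₁ x‖ ≤ δ → ‖fderiv ℝ F₂ (θ x)‖ ≤ δ → (∀ p q : E4, F₂ (θ x) p q = F₂ (θ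 x) q p) → (∀ y ∈ s, Literature.Geometry.Lorentzian.bilinPullback θ (fun z ↦ Minkowski.bilin + F₂ z) y = Minkowski.bilin + F₁ y) → ‖fderiv ℝ θ x‖ ≤ Θ → δ * (1 + Θ ^ 2) ≤ 1 / 2 → (∀ v w : E4, |Minkowski.bilin (fderiv ℝ θ x v) (fderiv ℝ θ x w) - Minkowski.bilin v w| ≤ δ * (1 + Θ ^ 2) * ‖v‖ * ‖w‖) ∧ ‖iteratedFDeriv ℝ 2 θ x‖ ≤ K * (δ + δ) := by
  intro Θ
  obtain ⟨K, hK0, HK⟩ := norm_iteratedFDeriv_two_le_of_bilinPullback_eq (2 * Θ) 2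
  refine ⟨K, hK0, ?_⟩
  intro θ F₁ F₂ s x δ hs hx hθ hF₁ hF₂ hF₁δ hF₂δ hdF₁ hdF₂ hsymm hpull hΘ hsmall
  -- (1) the intertwining identity at `x`, evaluated, and the defect bound
  have hid : ∀ v w : E4, Minkowski.bilin (fderiv ℝ θ x v) (fderiv ℝ θ x w) +
      F₂ (θ x) (fderiv ℝ θ x v) (fderiv ℝ θ x w) = Minkowski.bilin v w + F₁ x v w := by
    intro v w
    have h := congrArg (fun B : E4 →L[ℝ] E4 →L[ℝ] ℝ ↦ B v w) (hpull x hx)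
    simpa only [bilinPullback_apply, add_apply] using h
  have hdef : ∀ v w : E4, |Minkowski.bilin (fderiv ℝ θ x v) (fderiv ℝ θ x w) -
      Minkowski.bilin v w| ≤ δ * (1 + Θ ^ 2) * ‖v‖ * ‖w‖ :=
    abs_defect_le_of_intertwine hid hF₁δ hF₂δ hΘ
  -- (2) the lower bound on the Jacobian
  have hΘ0 : 0 ≤ Θ := (norm_nonneg _).trans hΘ
  have hlow : ∀ v : E4, ‖v‖ ≤ 2 * Θ * ‖fderiv ℝ θ x v‖ :=
    norm_le_two_mul_mul_norm_apply_of_defect_le hdef hsmall hΘ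
  -- (3) nondegeneracy of `η + F₂ (θ x)`
  have hδ0 : 0 ≤ δ := (norm_nonneg _).trans hF₁δ
  have hδhalf : δ ≤ 1 / 2 := by nlinarith [mul_nonneg hδ0 (sq_nonneg Θ)]
  have hν : ∀ p : E4, ‖p‖ ≤ 2 * ‖(Minkowski.bilin + F₂ (θ x)) p‖ :=
    norm_le_two_mul_norm_add_apply (hF₂δ.trans hδhalf)
  -- (4) the Christoffel transport brick with `(Θ', ν) = (2Θ, 2)`
  have hsymmB : ∀ p q : E4, (Minkowski.bilin + F₂ (θ x)) p q = (Minkowski.bilin + F₂ (θ x)) q p :=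
    fun p q ↦ by
      simp only [add_apply, Minkowski.bilin_symm p q, hsymm p q]
  have hΘ2 : ‖fderiv ℝ θ x‖ ≤ 2 * Θ := hΘ.trans (by linarith)
  have hB₁ : DifferentiableAt ℝ (fun y ↦ Minkowski.bilin + F₁ y) x := hF₁.const_add _
  have hB₂ : DifferentiableAt ℝ (fun z ↦ Minkowski.bilin + F₂ z) (θ x) := hF₂.const_add _
  have h4 := HK θ (fun y ↦ Minkowski.bilin + F₁ y) (fun z ↦ Minkowski.bilin + F₂ z) s x hs hx hθ
    hB₁ hB₂ hpull hsymmB hΘ2 hν hlow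
  rw [fderiv_const_add, fderiv_const_add] at h4
  refine ⟨hdef, h4.trans ?_⟩
  gcongr

/-! ### Seam rigidity (G1) on convex cells -/

/-- **Seam rigidity (G1) on convex cells** (brick `seamRigidityFlat_convex` for the registered stub
`stub_glueForwardChain` of crux `DriftCapture`). For every Jacobian bound `Θ`, diameter bound `dC`
and `ε > 0` there is `δ = δ(Θ, dC, ε) > 0` such that: on every convex open cell `C ⊆ E4` with
`‖x − y‖ ≤ dC` on `C`, for every `C²` transition map `θ` on `C` intertwining two metric fields
`η + F₂` (on the image) and `η + F₁` (on the cell) that are `δ`-close to `η` in `C¹`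
(`‖F₁(x)‖, ‖DF₁(x)‖, ‖F₂(θ x)‖, ‖DF₂(θ x)‖ ≤ δ` on `C`, `F₂(θ x)` symmetric), with `‖Dθ‖ ≤ Θ` on
`C`, and for every base point `x₀ ∈ C`, there is ONE Lorentz transformation `Λ ∈ O(1,3)` such that
on all of `C`: `‖Dθ(x) − Λ‖ ≤ ε` (`C¹`), `‖(θ x − θ x₀) − Λ(x − x₀)‖ ≤ ε‖x − x₀‖` (`C⁰`: `θ` is
close to the Poincaré map `x ↦ θ x₀ + Λ(x − x₀)`), and `‖D²θ(x)‖ ≤ ε` (`C²`). Proof: the pointwise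
core `seamRigidityFlat_pointwise` gives the defect bound `δ(1 + Θ²)` and the Hessian bound
`κ = K(δ + δ)` on `C`; the affine brick `exists_lorentzGroup_affine_near_of_fderiv2_le` (mean value
inequality on the convex cell plus compactness near `O(1,3)`) then produces `Λ`, the smallness
conditions being arranged by `exists_seamRigidityFlat_delta`. F. John 1961 (rotation and strain);
Reshetnyak, *Stability theorems in geometry and analysis*, Ch. 3; O'Neill 1983, Ch. 3 and Ch. 9.
No version on entire slabs is claimed (John's logarithmic drift). [folklore] -/
theorem seamRigidityFlat_convex : ∀ (Θ dC ε : ℝ), 0 < ε → ∃ δ : ℝ, 0 < δ ∧ ∀ (C : Set E4), IsOpen C → Convex ℝ C → (∀ x ∈ C, ∀ y ∈ C, ‖x - y‖ ≤ dC) → ∀ (θ : E4 → E4) (F₁ F₂ : E4 → E4 →L[ℝ] E4 →L[ℝ] ℝ), ContDiffOn ℝ 2 θ C → (∀ x ∈ C, DifferentiableAt ℝ F₁ x ∧ ‖F₁ x‖ ≤ δ ∧ ‖fderiv ℝ F₁ x‖ ≤ δ) → (∀ x ∈ C, DifferentiableAt ℝ F₂ (θ x) ∧ ‖F₂ (θ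 x)‖ ≤ δ ∧ ‖fderiv ℝ F₂ (θ x)‖ ≤ δ) → (∀ x ∈ C, ∀ p q : E4, F₂ (θ x) p q = F₂ (θ x) q p) → (∀ x ∈ C, Literature.Geometry.Lorentzian.bilinPullback θ (fun y ↦ Minkowski.bilin + F₂ y) x = Minkowski.bilin + F₁ x) → (∀ x ∈ C, ‖fderiv ℝ θ x‖ ≤ Θ) → ∀ x₀ ∈ C, ∃ Λ : lorentzGroup, ∀ x ∈ C, ‖fderiv ℝ θ x - ((Λ : E4 ≃L[ℝ] E4) : E4 →L[ℝ] E4)‖ ≤ ε ∧ ‖(θ x - θ x₀) - (Λ : E4 ≃L[ℝ] E4) (x - x₀)‖ ≤ ε * ‖x - x₀‖ ∧ ‖iteratedFDeriv ℝ 2 θ x‖ ≤ ε := by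
  intro Θ dC ε hε
  obtain ⟨K, hK0, HK⟩ := seamRigidityFlat_pointwise Θ
  obtain ⟨δa, hδa, Ha⟩ := exists_lorentzGroup_affine_near_of_fderiv2_le Θ ε hε
  obtain ⟨δ, hδ, hδ1, hδ2, hδ3, hδ4⟩ := exists_seamRigidityFlat_delta Θ dC ε K δa hε hK0 hδa
  refine ⟨δ, hδ, ?_⟩
  intro C hCo hCc hdC θ F₁ F₂ hθ hF₁ hF₂ hsymm hpull hΘ x₀ hx₀
  -- the pointwise core at every point of the open cell
  have hpt : ∀ x ∈ C, (∀ v w : E4, |Minkowski.bilin (fderiv ℝ θ x v) (fderiv ℝ θ x w) -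
      Minkowski.bilin v w| ≤ δ * (1 + Θ ^ 2) * ‖v‖ * ‖w‖) ∧
        ‖iteratedFDeriv ℝ 2 θ x‖ ≤ K * (δ + δ) := fun x hx ↦
    HK θ F₁ F₂ C x δ hCo hx hθ (hF₁ x hx).1 (hF₂ x hx).1 (hF₁ x hx).2.1 (hF₂ x hx).2.1
      (hF₁ x hx).2.2 (hF₂ x hx).2.2 (hsymm x hx) hpull (hΘ x hx) hδ1
  -- derivatives within the open cell
  have hd1 : ∀ x ∈ C, HasFDerivWithinAt θ (fderiv ℝ θ x) C x := fun x hx ↦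
    ((hθ.contDiffAt (hCo.mem_nhds hx)).differentiableAt two_ne_zero).hasFDerivAt.hasFDerivWithinAt
  have hd2 : ∀ x ∈ C, HasFDerivWithinAt (fderiv ℝ θ) (fderiv ℝ (fderiv ℝ θ) x) C x := fun x hx ↦
    (((hθ.contDiffAt (hCo.mem_nhds hx)).fderiv_right (m := 1) le_rfl).differentiableAt
      one_ne_zero).hasFDerivAt.hasFDerivWithinAt
  have hκ : ∀ x ∈ C, ‖fderiv ℝ (fderiv ℝ θ) x‖ ≤ K * (δ + δ) := fun x hx ↦ by
    have h := (hpt x hx).2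
    rwa [← norm_iteratedFDeriv_fderiv, norm_iteratedFDeriv_one] at h
  have hdC' : ∀ x ∈ C, ∀ y ∈ C, ‖x - y‖ ≤ |dC| := fun x hx y hy ↦
    (hdC x hx y hy).trans (le_abs_self dC)
  have hdef : ∀ x ∈ C, ∀ v w : E4, |Minkowski.bilin (fderiv ℝ θ x v) (fderiv ℝ θ x w) -
      Minkowski.bilin v w| ≤ δa * ‖v‖ * ‖w‖ := fun x hx v w ↦
    ((hpt x hx).1 v w).trans (mul_le_mul_of_nonneg_right
      (mul_le_mul_of_nonneg_right hδ2 (norm_nonneg _)) (norm_nonneg _))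
  obtain ⟨Λ, h1, h0⟩ := Ha C hCc θ (fderiv ℝ θ) (fderiv ℝ (fderiv ℝ θ)) (K * (δ + δ)) |dC| hd1 hd2
    hΘ hκ hdC' hδ4 hdef x₀ hx₀
  exact ⟨Λ, fun x hx ↦ ⟨h1 x hx, h0 x hx, (hpt x hx).2.trans hδ3⟩⟩

end Summit.FinalStateConjecture.FinalStateConjecture.Theorems.RenormalisedDrift.DriftCapture

end
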